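import Summits.CriticalPhenomena.CardyFormulaZ2.Theorems.CardyIKTransportIKLinearTransportLine

/-!
# Stub `stub_ConditionalRSW` (crux stmt-CriticalPhenomena-5076, line `pinned-diagram-exchange`):
# finite energy of the column-mixed IK gauge, III — the conditional bound at every fixed scale

Helpers toward the registered stub
`stub_ConditionalRSW : ∃ c, 0 < c ∧ ∀ S n, 1 ≤ n → ∀ a b E, MeasurableSet E → CondRSWBound c S n a b E`.
MAIN RESULT `condRSWBound_fixedScale_of_cellFlips`: if every cell `c` admits a flip `Φ_c` of `Ω`
(measurable, `μIK ∘ Φ_c⁻¹ ≤ K • μIK` with `K < ∞`, diagonal coins fixed, toggling the colour of `c` and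
of no other cell for every `S` — hypothesis `hcell`, discharged for the explicit gauge by the companion
files `…StubConditionalRSWFlips` + `…StubConditionalRSWCells` with `K = min(q,1-q)⁻⁴`, `q = 2√3-3`),
then for every `n ≥ 1` there is `c_n > 0` (namely `(2K)^{-2n²}`) with `CondRSWBound c_n S n a b E` for
EVERY column pattern `S`, box position `(a, b)` and measurable `E`. So the stub holds scale by scale,
uniformly in `S` and `E`; what it asks beyond this file is the uniformity of `c` in `n` — box-crossing
(RSW) bounds for the non-FKG colour field, route item stmt-CriticalPhenomena-5911.

Proof (finite energy by local modification, no FKG, no Markov property needed).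
`crsw_measure_preimage_le_of_cellFlips`: for `E` determined by `Λ` and a finite set `B` of cells off `Λ`,
`μIK(obs⁻¹E) ≤ (2K)^{|B|} μIK(obs⁻¹E ∩ {B all black})`, by induction on `B`: split along the colour of
the new cell `c`; on the white part apply `Φ_c`, which keeps `obs⁻¹E` (far event, `crsw_obs_mem_iff_of_cellFlip`)
and the colours of the other cells, and costs the factor `K` (`μ(Φ⁻¹U) ≤ K μ(U)` for ALL sets `U`,
`crsw_preimage_le_of_map_le`). An all-black `2n × n` (resp. `n × 2n`) box is crossed the long way along a row
(column) for every diagonal configuration (`crsw_mem_lrCross_of_allBlack`, `crsw_mem_tbCross_of_allBlack`: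
horizontal/vertical neighbours are always edges of the triangulation). Measurability of `obs S` is not
needed: if it fails, `νmix S = 0`; otherwise `map_apply_of_aemeasurable` on `E` and `le_map_apply` on
`E ∩ crossing` (`crsw_condBound_of_cellFlips`).
-/

noncomputable section

namespace Summit.CriticalPhenomena.CardyFormulaZ2.Theorems.IKLinearTransport.PinnedDiagramExchange

open scoped BigOperators Classical MeasureTheory ProbabilityTheory ENNReal
open Set Function MeasureTheory
open Literature.Probability.Percolation Literature.Probability.LatticeModels

/-! ## §1 Far events are invariant under single-cell flips -/

/-- A flip toggling exactly the cell `c ∉ Λ` and fixing the coins does not change whether the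
observables lie in an event determined by `Λ`. [folklore] -/
theorem crsw_obs_mem_iff_of_cellFlip {Λ : Set (Site 2)} {E : Set Obs} (hE : E ∈ determinedOn Λ) {c : Site 2}
    (hc : c ∉ Λ) {Φ : Ω → Ω} (hΦc : ∀ ω, (Φ ω).2.2.2.2 = ω.2.2.2.2)
    (hΦt : ∀ (S : Set ℤ) (ω : Ω) (v : Site 2), v ∈ blackSet S (Φ ω) ↔ Xor (v ∈ blackSet S ω) (v = c))
    (S : Set ℤ) (ω : Ω) : obs S (Φ ω) ∈ E ↔ obs S ω ∈ E := by
  refine hE (obs S (Φ ω)) (obs S ω) fun v hv => ⟨?_, ?_⟩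
  · have hvc : v ≠ c := fun h => hc (h ▸ hv)
    show v ∈ blackSet S (Φ ω) ↔ v ∈ blackSet S ω
    rw [hΦt, xor_def]
    constructor
    · rintro (⟨h, -⟩ | ⟨h, -⟩)
      · exact h
      · exact absurd h hvc
    · exact fun h => Or.inl ⟨h, hvc⟩
  · show v ∈ antiSet S (Φ ω) ↔ v ∈ antiSet S ω
    simp only [antiSet, Set.mem_setOf_eq, hΦc]

/-- From the quasi-invariance of the law to the bound on preimages of ALL sets. [folklore] -/
theorem crsw_preimage_le_of_map_le {α : Type*} [MeasurableSpace α] {μ : Measure α} {f : α → α}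
    (hf : Measurable f) {K : ℝ≥0∞} (h : μ.map f ≤ K • μ) (U : Set α) : μ (f ⁻¹' U) ≤ K * μ U :=
  (Measure.le_map_apply hf.aemeasurable U).trans (h U)

/-- A quasi-invariance factor of a probability measure is at least `1`. [folklore] -/
theorem crsw_one_le_of_map_le {Φ : Ω → Ω} (hΦm : Measurable Φ) {K : ℝ≥0∞} (h : μIK.map Φ ≤ K • μIK) : 1 ≤ K := by
  haveI : IsProbabilityMeasure μIK := by unfold μIK; infer_instance
  have h1 := h Set.univ
  rw [Measure.map_apply hΦm MeasurableSet.univ, Set.preimage_univ, Measure.smul_apply, smul_eq_mul,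
    measure_univ, mul_one] at h1
  exact h1

/-! ## §2 Finite energy: forcing a finite set of cells black costs a bounded factor -/

/-- FINITE ENERGY OF THE GAUGE COLOUR FIELD. If every cell admits a flip with factor `K` (hypothesis
`hcell`, discharged by the companion files), then for every column pattern `S`, every event `E` of
observables determined by `Λ` and every finite set `B` of cells off `Λ`:
`μIK(obs⁻¹ E) ≤ (2K)^{|B|} · μIK(obs⁻¹ E ∩ {all cells of B black})`. [folklore] -/
theorem crsw_measure_preimage_le_of_cellFlips {K : ℝ≥0∞}
    (hcell : ∀ c : Site 2, ∃ Φ : Ω → Ω, Measurable Φ ∧ μIK.map Φ ≤ K • μIK ∧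
      (∀ ω, (Φ ω).2.2.2.2 = ω.2.2.2.2) ∧
      ∀ (S : Set ℤ) (ω : Ω) (v : Site 2), v ∈ blackSet S (Φ ω) ↔ Xor (v ∈ blackSet S ω) (v = c))
    (S : Set ℤ) {Λ : Set (Site 2)} {E : Set Obs} (hE : E ∈ determinedOn Λ) (B : Finset (Site 2))
    (hB : ∀ c ∈ B, c ∉ Λ) :
    μIK (obs S ⁻¹' E) ≤
      (2 * K) ^ B.card * μIK (obs S ⁻¹' E ∩ {ω | ∀ c ∈ B, c ∈ blackSet S ω}) := by
  induction B using Finset.induction_on with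
  | empty => simp
  | insert c B hcB ih =>
    have hB' : ∀ c' ∈ B, c' ∉ Λ := fun c' hc' => hB c' (Finset.mem_insert_of_mem hc')
    have hcΛ : c ∉ Λ := hB c (Finset.mem_insert_self c B)
    obtain ⟨Φ, hΦm, hΦb, hΦc, hΦt⟩ := hcell c
    have hK1 : 1 ≤ K := crsw_one_le_of_map_le hΦm hΦb
    set A := obs S ⁻¹' E ∩ {ω | ∀ c' ∈ B, c' ∈ blackSet S ω} with hA
    set A' := obs S ⁻¹' E ∩ {ω | ∀ c' ∈ insert c B, c' ∈ blackSet S ω} with hA'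
    have h1 : A ∩ {ω | c ∈ blackSet S ω} ⊆ A' := by
      rintro ω ⟨⟨hωE, hωB⟩, hωc⟩
      refine ⟨hωE, fun c' hc' => ?_⟩
      rcases Finset.mem_insert.1 hc' with rfl | hc'B
      · exact hωc
      · exact hωB c' hc'B
    have h2 : A \ {ω | c ∈ blackSet S ω} ⊆ Φ ⁻¹' A' := by
      rintro ω ⟨⟨hωE, hωB⟩, hωc⟩
      refine ⟨(crsw_obs_mem_iff_of_cellFlip hE hcΛ hΦc hΦt S ω).2 hωE, fun c' hc' => ?_⟩
      show c' ∈ blackSet S (Φ ω)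
      rw [hΦt, xor_def]
      rcases Finset.mem_insert.1 hc' with rfl | hc'B
      · exact Or.inr ⟨rfl, hωc⟩
      · exact Or.inl ⟨hωB c' hc'B, fun h => hcB (h ▸ hc'B)⟩
    calc μIK (obs S ⁻¹' E) ≤ (2 * K) ^ B.card * μIK A := ih hB'
      _ ≤ (2 * K) ^ B.card * (μIK (A ∩ {ω | c ∈ blackSet S ω}) + μIK (A \ {ω | c ∈ blackSet S ω})) :=
          mul_le_mul' le_rfl (measure_le_inter_add_sdiff _ _ _)
      _ ≤ (2 * K) ^ B.card * (μIK A' + K * μIK A') :=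
          mul_le_mul' le_rfl (add_le_add (measure_mono h1)
            ((measure_mono h2).trans (crsw_preimage_le_of_map_le hΦm hΦb A')))
      _ ≤ (2 * K) ^ B.card * (K * μIK A' + K * μIK A') :=
          mul_le_mul' le_rfl (add_le_add (le_mul_of_one_le_left bot_le hK1) le_rfl)
      _ = (2 * K) ^ (insert c B).card * μIK A' := by
          rw [Finset.card_insert_of_notMem hcB, pow_succ]; ring

/-! ## §3 An all-black box is crossed the long way, whatever the diagonals -/

/-- A straight run of black cells inside `Bx` in the direction `e ∈ {(1,0), (0,1)}` is an open path of
the triangulation (horizontal and vertical neighbours are joined for every diagonal configuration). [folklore] -/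
theorem crsw_reachable_of_blackRun (x : Obs) (Bx : Set (Site 2)) (u e : Site 2) (he : e = ![1, 0] ∨ e = ![0, 1])
    (k : ℕ) (hmem : ∀ i : ℕ, i ≤ k → u + (i : ℤ) • e ∈ Bx)
    (hblack : ∀ i : ℕ, i ≤ k → u + (i : ℤ) • e ∈ x.1) :
    ((openGraph (blackEdges x)).induce Bx).Reachable ⟨u + ((0 : ℕ) : ℤ) • e, hmem 0 (Nat.zero_le k)⟩
      ⟨u + (k : ℤ) • e, hmem k le_rfl⟩ := by
  have he0 : e ≠ 0 := by
    rcases he with rfl | rfl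
    · intro h; have := congrFun h 0; simp at this
    · intro h; have := congrFun h 1; simp at this
  induction k with
  | zero => exact SimpleGraph.Reachable.refl _
  | succ k ih =>
    have hmem' : ∀ i : ℕ, i ≤ k → u + (i : ℤ) • e ∈ Bx := fun i hi => hmem i (Nat.le_succ_of_le hi)
    have hblack' : ∀ i : ℕ, i ≤ k → u + (i : ℤ) • e ∈ x.1 := fun i hi => hblack i (Nat.le_succ_of_le hi)
    refine (ih hmem' hblack').trans (SimpleGraph.Adj.reachable ?_)
    rw [SimpleGraph.induce_adj, openGraph_adj]
    have hstep : u + ((k + 1 : ℕ) : ℤ) • e = u + (k : ℤ) • e + e := by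
      rw [Nat.cast_succ, add_smul, one_smul, add_assoc]
    refine ⟨⟨u + (k : ℤ) • e, u + ((k + 1 : ℕ) : ℤ) • e, rfl, hblack k (Nat.le_succ k),
      hblack (k + 1) le_rfl, ?_⟩, fun h => he0 ?_⟩
    · rcases he with rfl | rfl
      · exact Or.inl hstep
      · exact Or.inr (Or.inl hstep)
    · have h' : u + (k : ℤ) • e + e = u + (k : ℤ) • e + 0 := by rw [← hstep, add_zero]; exact h.symm
      exact add_left_cancel h'

/-- Coordinates along a horizontal run. [folklore] -/
theorem crsw_hrun_apply (a b : ℤ) (i : ℕ) :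
    ((![a, b] + (i : ℤ) • ![1, 0] : Site 2) 0) = a + i ∧ ((![a, b] + (i : ℤ) • ![1, 0] : Site 2) 1) = b := by
  simp

/-- Coordinates along a vertical run. [folklore] -/
theorem crsw_vrun_apply (a b : ℤ) (i : ℕ) :
    ((![a, b] + (i : ℤ) • ![0, 1] : Site 2) 0) = a ∧ ((![a, b] + (i : ℤ) • ![0, 1] : Site 2) 1) = b + i := by
  simp

/-- AN ALL-BLACK `2n × n` BOX is crossed from left to right (along its bottom row). [folklore] -/
theorem crsw_mem_lrCross_of_allBlack (a b : ℤ) (m : ℕ) (x : Obs)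
    (hblack : ∀ v : Site 2, a ≤ v 0 → v 0 < a + (2 * (m + 1) : ℕ) → b ≤ v 1 → v 1 < b + (m + 1 : ℕ) →
      v ∈ x.1) :
    x ∈ lrCross a b (2 * (m + 1)) (m + 1) := by
  have hmem : ∀ i : ℕ, i ≤ 2 * m + 1 → (![a, b] : Site 2) + (i : ℤ) • ![1, 0] ∈
      {v : Site 2 | a ≤ v 0 ∧ v 0 < a + (2 * (m + 1) : ℕ) ∧ b ≤ v 1 ∧ v 1 < b + (m + 1 : ℕ)} := by
    intro i hi
    simp only [Set.mem_setOf_eq, (crsw_hrun_apply a b i).1, (crsw_hrun_apply a b i).2]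
    push_cast; omega
  have hbl : ∀ i : ℕ, i ≤ 2 * m + 1 → (![a, b] : Site 2) + (i : ℤ) • ![1, 0] ∈ x.1 := by
    intro i hi
    have h := hmem i hi
    exact hblack _ h.1 h.2.1 h.2.2.1 h.2.2.2
  have hreach := crsw_reachable_of_blackRun x _ ![a, b] ![1, 0] (Or.inl rfl) (2 * m + 1) hmem hbl
  simp only [lrCross, Set.mem_setOf_eq, mem_openCrossing_iff]
  refine ⟨(![a, b] : Site 2) + ((0 : ℕ) : ℤ) • ![1, 0], ?_, (![a, b] : Site 2) + ((2 * m + 1 : ℕ) : ℤ) • ![1, 0],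
    ?_, ⟨hmem 0 (Nat.zero_le _), hmem _ le_rfl, hreach⟩⟩
  · simp only [(crsw_hrun_apply a b 0).1, (crsw_hrun_apply a b 0).2]
    push_cast; omega
  · simp only [(crsw_hrun_apply a b (2 * m + 1)).1, (crsw_hrun_apply a b (2 * m + 1)).2]
    push_cast; omega

/-- AN ALL-BLACK `n × 2n` BOX is crossed from bottom to top (along its left column). [folklore] -/
theorem crsw_mem_tbCross_of_allBlack (a b : ℤ) (m : ℕ) (x : Obs)
    (hblack : ∀ v : Site 2, a ≤ v 0 → v 0 < a + (m + 1 : ℕ) → b ≤ v 1 → v 1 < b + (2 * (m + 1) : ℕ) →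
      v ∈ x.1) :
    x ∈ tbCross a b (m + 1) (2 * (m + 1)) := by
  have hmem : ∀ i : ℕ, i ≤ 2 * m + 1 → (![a, b] : Site 2) + (i : ℤ) • ![0, 1] ∈
      {v : Site 2 | a ≤ v 0 ∧ v 0 < a + (m + 1 : ℕ) ∧ b ≤ v 1 ∧ v 1 < b + (2 * (m + 1) : ℕ)} := by
    intro i hi
    simp only [Set.mem_setOf_eq, (crsw_vrun_apply a b i).1, (crsw_vrun_apply a b i).2]
    push_cast; omega
  have hbl : ∀ i : ℕ, i ≤ 2 * m + 1 → (![a, b] : Site 2) + (i : ℤ) • ![0, 1] ∈ x.1 := by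
    intro i hi
    have h := hmem i hi
    exact hblack _ h.1 h.2.1 h.2.2.1 h.2.2.2
  have hreach := crsw_reachable_of_blackRun x _ ![a, b] ![0, 1] (Or.inr rfl) (2 * m + 1) hmem hbl
  simp only [tbCross, Set.mem_setOf_eq, mem_openCrossing_iff]
  refine ⟨(![a, b] : Site 2) + ((0 : ℕ) : ℤ) • ![0, 1], ?_, (![a, b] : Site 2) + ((2 * m + 1 : ℕ) : ℤ) • ![0, 1],
    ?_, ⟨hmem 0 (Nat.zero_le _), hmem _ le_rfl, hreach⟩⟩
  · simp only [(crsw_vrun_apply a b 0).1, (crsw_vrun_apply a b 0).2]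
    push_cast; omega
  · simp only [(crsw_vrun_apply a b (2 * m + 1)).1, (crsw_vrun_apply a b (2 * m + 1)).2]
    push_cast; omega

/-! ## §4 The conditional bound at a fixed scale, for every column pattern -/

/-- Membership in the finite set of cells of the box `[a, a+w) × [b, b+h)`. [folklore] -/
theorem crsw_mem_boxCells_iff (a b : ℤ) (w h : ℕ) (c : Site 2) :
    c ∈ ((Finset.Ico a (a + w)) ×ˢ (Finset.Ico b (b + h))).image (fun p : ℤ × ℤ => (![p.1, p.2] : Site 2)) ↔
      a ≤ c 0 ∧ c 0 < a + w ∧ b ≤ c 1 ∧ c 1 < b + h := by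
  simp only [Finset.mem_image, Finset.mem_product, Finset.mem_Ico]
  constructor
  · rintro ⟨p, ⟨⟨h1, h2⟩, h3, h4⟩, rfl⟩
    simp only [Matrix.cons_val_zero, Matrix.cons_val_one, Matrix.cons_val_fin_one]
    exact ⟨h1, h2, h3, h4⟩
  · rintro ⟨h1, h2, h3, h4⟩
    exact ⟨(c 0, c 1), ⟨⟨h1, h2⟩, h3, h4⟩, by ext i; fin_cases i <;> rfl⟩

/-- The box `[a, a+w) × [b, b+h)` has at most `w h` cells. [folklore] -/
theorem crsw_card_boxCells_le (a b : ℤ) (w h : ℕ) :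
    (((Finset.Ico a (a + w)) ×ˢ (Finset.Ico b (b + h))).image
      (fun p : ℤ × ℤ => (![p.1, p.2] : Site 2))).card ≤ w * h := by
  refine Finset.card_image_le.trans ?_
  rw [Finset.card_product, Int.card_Ico, Int.card_Ico]
  simp

/-- The finite-energy factor `(2K)^N` is finite, positive, and at least `1`. [folklore] -/
theorem crsw_factor_props {K : ℝ≥0∞}
    (hcell : ∀ c : Site 2, ∃ Φ : Ω → Ω, Measurable Φ ∧ μIK.map Φ ≤ K • μIK ∧
      (∀ ω, (Φ ω).2.2.2.2 = ω.2.2.2.2) ∧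
      ∀ (S : Set ℤ) (ω : Ω) (v : Site 2), v ∈ blackSet S (Φ ω) ↔ Xor (v ∈ blackSet S ω) (v = c))
    (hKtop : K ≠ ∞) (N : ℕ) : 1 ≤ 2 * K ∧ (2 * K) ^ N ≠ ∞ ∧ 0 < ((2 * K) ^ N).toReal := by
  obtain ⟨Φ, hΦm, hΦb, -, -⟩ := hcell 0
  have hK1 : 1 ≤ K := crsw_one_le_of_map_le hΦm hΦb
  have h2K1 : 1 ≤ 2 * K := hK1.trans (le_mul_of_one_le_left bot_le one_le_two)
  have hMtop : (2 * K) ^ N ≠ ∞ := ENNReal.pow_ne_top (ENNReal.mul_ne_top ENNReal.ofNat_ne_top hKtop)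
  exact ⟨h2K1, hMtop, ENNReal.toReal_pos (pow_ne_zero _ (one_pos.trans_le h2K1).ne') hMtop⟩

/-- CONDITIONAL BOUND FROM FINITE ENERGY. For an observable event `E` (measurable, determined by `Λ`)
and an event `C` implied by "all cells of `B` black" (`B` finite, off `Λ`, `|B| ≤ N`):
`(2K)^{-N} · ν_S(E) ≤ ν_S(E ∩ C)`, for EVERY column pattern `S`. [folklore] -/
theorem crsw_condBound_of_cellFlips {K : ℝ≥0∞}
    (hcell : ∀ c : Site 2, ∃ Φ : Ω → Ω, Measurable Φ ∧ μIK.map Φ ≤ K • μIK ∧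
      (∀ ω, (Φ ω).2.2.2.2 = ω.2.2.2.2) ∧
      ∀ (S : Set ℤ) (ω : Ω) (v : Site 2), v ∈ blackSet S (Φ ω) ↔ Xor (v ∈ blackSet S ω) (v = c))
    (hKtop : K ≠ ∞) (S : Set ℤ) {Λ : Set (Site 2)} {E C : Set Obs} (hE : MeasurableSet E)
    (hdet : E ∈ determinedOn Λ) (B : Finset (Site 2)) (hBΛ : ∀ c ∈ B, c ∉ Λ)
    (hBC : ∀ x : Obs, (∀ c ∈ B, c ∈ x.1) → x ∈ C) {N : ℕ} (hN : B.card ≤ N) :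
    (((2 * K) ^ N).toReal)⁻¹ * (νmix S).real E ≤ (νmix S).real (E ∩ C) := by
  haveI : IsProbabilityMeasure μIK := by unfold μIK; infer_instance
  obtain ⟨h2K1, hMtop, hMpos⟩ := crsw_factor_props hcell hKtop N
  by_cases hobs : AEMeasurable (obs S) μIK
  · have key : μIK (obs S ⁻¹' E) ≤ (2 * K) ^ N * μIK (obs S ⁻¹' E ∩ {ω | ∀ c ∈ B, c ∈ blackSet S ω}) :=
      (crsw_measure_preimage_le_of_cellFlips hcell S hdet B hBΛ).trans
        (mul_le_mul' (pow_le_pow_right₀ h2K1 hN) le_rfl)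
    have hsub : obs S ⁻¹' E ∩ {ω | ∀ c ∈ B, c ∈ blackSet S ω} ⊆ obs S ⁻¹' (E ∩ C) :=
      fun ω hω => ⟨hω.1, hBC (obs S ω) hω.2⟩
    have hineq : νmix S E ≤ (2 * K) ^ N * νmix S (E ∩ C) := by
      rw [νmix, Measure.map_apply_of_aemeasurable hobs hE]
      exact key.trans (mul_le_mul' le_rfl ((measure_mono hsub).trans (Measure.le_map_apply hobs _)))
    have hfin : νmix S (E ∩ C) ≠ ∞ := by rw [νmix]; exact measure_ne_top _ _
    rw [inv_mul_le_iff₀ hMpos, measureReal_def, measureReal_def, ← ENNReal.toReal_mul]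
    exact ENNReal.toReal_mono (ENNReal.mul_ne_top hMtop hfin) hineq
  · simp [measureReal_def, νmix, Measure.map_of_not_aemeasurable hobs]

/-- CONDITIONAL RSW AT A FIXED SCALE, FOR EVERY COLUMN PATTERN (the finite-energy part of the stub
`stub_ConditionalRSW`). Given single-cell flips with a finite factor `K` (hypothesis `hcell`, proved
for the explicit gauge in the companion files), for every `n ≥ 1` there is `c_n > 0` — explicitly
`c_n = (2K)^{-2n²}` — such that `CondRSWBound c_n S n a b E` holds for every `S`, `a`, `b` and every
measurable `E`: conditionally on any event determined by the far cells, the `2n × n` (resp. `n × 2n`)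
box is entirely black, hence crossed the long way, with probability `≥ c_n`. The stub asks for `c`
uniform in `n`, which is the RSW content (route item stmt-5911). [folklore] -/
theorem condRSWBound_fixedScale_of_cellFlips : ∀ {K : ENNReal},
    (∀ c : Site 2, ∃ Φ : Ω → Ω, Measurable Φ ∧ μIK.map Φ ≤ K • μIK ∧ (∀ ω, (Φ ω).2.2.2.2 = ω.2.2.2.2) ∧
      ∀ (S : Set ℤ) (ω : Ω) (v : Site 2), v ∈ blackSet S (Φ ω) ↔ Xor (v ∈ blackSet S ω) (v = c)) →
    K ≠ ⊤ → ∀ n : ℕ, 1 ≤ n →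
      ∃ c : ℝ, 0 < c ∧ ∀ (S : Set ℤ) (a b : ℤ) (E : Set Obs), MeasurableSet E → CondRSWBound c S n a b E := by
  intro K hcell hKtop n hn
  obtain ⟨m, rfl⟩ : ∃ m, n = m + 1 := ⟨n - 1, by omega⟩
  obtain ⟨-, -, hMpos⟩ := crsw_factor_props hcell hKtop (2 * (m + 1) * (m + 1))
  refine ⟨(((2 * K) ^ (2 * (m + 1) * (m + 1))).toReal)⁻¹, inv_pos.2 hMpos,
    fun S a b E hE => ⟨fun hdet => ?_, fun hdet => ?_⟩⟩
  · refine crsw_condBound_of_cellFlips hcell hKtop S hE hdet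
      (((Finset.Ico a (a + (2 * (m + 1) : ℕ))) ×ˢ (Finset.Ico b (b + (m + 1 : ℕ)))).image
        (fun p : ℤ × ℤ => (![p.1, p.2] : Site 2))) (fun c hc hfar => ?_)
      (fun x hx => crsw_mem_lrCross_of_allBlack a b m x fun v h1 h2 h3 h4 =>
        hx v ((crsw_mem_boxCells_iff _ _ _ _ v).2 ⟨h1, h2, h3, h4⟩)) (crsw_card_boxCells_le _ _ _ _)
    rw [crsw_mem_boxCells_iff] at hc
    simp only [farFrom, Set.mem_setOf_eq] at hfar
    push_cast at hc hfar
    omega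
  · refine crsw_condBound_of_cellFlips hcell hKtop S hE hdet
      (((Finset.Ico a (a + (m + 1 : ℕ))) ×ˢ (Finset.Ico b (b + (2 * (m + 1) : ℕ)))).image
        (fun p : ℤ × ℤ => (![p.1, p.2] : Site 2))) (fun c hc hfar => ?_)
      (fun x hx => crsw_mem_tbCross_of_allBlack a b m x fun v h1 h2 h3 h4 =>
        hx v ((crsw_mem_boxCells_iff _ _ _ _ v).2 ⟨h1, h2, h3, h4⟩))
      ((crsw_card_boxCells_le _ _ _ _).trans (le_of_eq (by ring)))
    rw [crsw_mem_boxCells_iff] at hc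
    simp only [farFrom, Set.mem_setOf_eq] at hfar
    push_cast at hc hfar
    omega

end Summit.CriticalPhenomena.CardyFormulaZ2.Theorems.IKLinearTransport.PinnedDiagramExchange
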